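import Mathlib.Algebra.Group.Basic
import Mathlib.Data.Fintype.Card
import Mathlib.Data.Fintype.Prod
import Mathlib.Data.Finset.Card
import Mathlib.Tactic.Group
import Mathlib.Tactic.SplitIfs
import HarnessLib

/-!
# Association schemes (class-map presentation) and realisation of `⟨ℓ, m, n⟩`

Topic `Literature/Combinatorics/AssociationSchemes`; work item `defn-AssociationScheme.Realizes`
(route `MatrixMultiplication/CommutativeSchemes`, cards `fuzzy-tpp-cyclotomic-schur-rings`,
`special-weights-s-rank`). Two notions of Cohn–Umans 2013 (*Fast matrix multiplication using
coherent configurations*, SODA 2013 = arXiv:1207.6528), in the form the route inlines them: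

* `AssociationScheme X ι` — an association scheme on the finite point set `X` with classes
  labelled by `ι`, presented by its **class map** `cls : X → X → ι` (`cls x y` = the label of the
  class containing `(x, y)`): (a) the diagonal is a single class (`cls x y = cls z z ↔ x = y`),
  (b) the classes are closed under transposition (`cls y x = τ (cls x y)` for some `τ`), and
  (c) coherence: `#{z | cls x z = a ∧ cls z y = b} = p a b (cls x y)` for some table of
  intersection numbers `p` [CU13 §4.2, conditions (1)–(3) + "association scheme if the diagonal is
  itself one of the classes"; Bannai–Ito; Brouwer–Cohen–Neumaier §2.1 (symmetric case)].
  `IsCommutative` (`p a b c = p b a c`, stated intrinsically; `isCommutative_iff` is the `∃ p`-form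
  used by the route), `IsSymmetric`, and `IsSymmetric.isCommutative` (CU13 §4.2: "Symmetry implies
  commutativity").
* `IsTriangle cls i j k` (CU13 Def. 11: some `x y z` with `(x,y) ∈ R_i`, `(y,z) ∈ R_j`,
  `(z,x) ∈ R_k`) and `Realizes cls ℓ m n` (CU13 Def. 12: injections
  `α : [ℓ]×[m] → ι`, `β : [m]×[n] → ι`, `γ : [n]×[ℓ] → ι` with `α(a,b'), β(b,c'), γ(c,a')` a
  triangle iff `a = a' ∧ b = b' ∧ c = c'`), for an ARBITRARY class map `cls : X → X → ι` — the
  definition only uses the numbering of the classes, and the route applies it verbatim to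
  distance maps `G.dist : X → X → ℕ`, Hamming distance and translation class functions; the
  dot-notation forms `AssociationScheme.IsTriangle`, `AssociationScheme.Realizes` specialise to a
  scheme's class map.
* `AssociationScheme.ofGroup G` — the group scheme `R_g = {(h, hg)}` of a finite group, i.e.
  `cls h k = h⁻¹ k` (CU13 §4.2), commutative iff `G` is (`ofGroup_isCommutative` proves "if").

## Design notes

* Labels `ι` instead of `Fin r`: the route takes `ι = Fin r`; distance schemes take `ι = ℕ`.
  Classes are allowed to be empty (`cls` need not be surjective), so `Fintype.card ι` (or `r`) is
  an UPPER BOUND for the rank in CU13's sense, which is `AssociationScheme.rank` = the number of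
  nonempty classes (`rank_le_card`); restricting the labels to the image of `cls` loses nothing, and
  Conjecture 21 / the route only ever bound the rank from above.
* With `ι = Fin r` the conjunction
  `(∀ x y z, cls x y = cls z z ↔ x = y) ∧ (∃ τ, …) ∧ (∃ p, (∀ a b x y, #… = p a b (cls x y)) ∧
  ∀ a b c, p a b c = p b a c)` inlined in `Summits/…/Theses/CommutativeSchemes.lean`
  (`CommutativeRealization`, `RealizationSRank`) is exactly "`⟨cls, (a), (b), (c)⟩ :
  AssociationScheme X (Fin r)` is commutative" by `isCommutative_iff`, and its realisation clause
  is `Realizes cls n n n` by `Iff.rfl` (`realizes_iff`).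
* Coherent configurations with several fibres (diagonal = a union of classes), the adjacency
  algebra, s-rank (CU13 Def. 1), Prop. 9 / Thm. 17 / Conj. 21 are NOT vendored here (the route
  files the results it needs as items; Conj. 21 is its target).

## References

* H. Cohn, C. Umans, *Fast matrix multiplication using coherent configurations*, SODA 2013,
  1074–1087, arXiv:1207.6528 — §4.2 (coherent configurations, association schemes, group
  schemes), §4.4 Def. 11 (triangle), Def. 12 (realizes `⟨ℓ,m,n⟩`), Example 13, Prop. 14.
* A. E. Brouwer, A. M. Cohen, A. Neumaier, *Distance-Regular Graphs*, Springer 1989, §2.1.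
-/

namespace Literature.Combinatorics.AssociationSchemes

open Finset Function

variable {X : Type*} {ι κ : Type*}

/-! ## Triangles and realisation for a class map (CU13 Def. 11, Def. 12) -/

section ClassMap

/-- **Triangle of classes** (Cohn–Umans 2013, Def. 11), for a class map `cls : X → X → ι`
(`cls x y` = label of the class of the ordered pair `(x, y)`): the classes `i, j, k` *form a
triangle* if there are points `x, y, z` with `cls x y = i`, `cls y z = j` and `cls z x = k`.
[cite: CohnUmans2013, Def. 11] -/
def IsTriangle (cls : X → X → ι) (i j k : ι) : Prop :=
  ∃ x y z : X, cls x y = i ∧ cls y z = j ∧ cls z x = k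

/-- **Realising `⟨ℓ, m, n⟩`** (Cohn–Umans 2013, Def. 12), for a class map `cls : X → X → ι`
with a fixed labelling `ι` of the classes: there are three injective maps
`α : [ℓ] × [m] → ι`, `β : [m] × [n] → ι`, `γ : [n] × [ℓ] → ι` such that
`α (a, b')`, `β (b, c')`, `γ (c, a')` form a triangle iff `a = a'`, `b = b'` and `c = c'`.
[cite: CohnUmans2013, Def. 12] -/
def Realizes (cls : X → X → ι) (l m n : ℕ) : Prop :=
  ∃ (α : Fin l × Fin m → ι) (β : Fin m × Fin n → ι) (γ : Fin n × Fin l → ι),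
    Injective α ∧ Injective β ∧ Injective γ ∧
      ∀ (a a' : Fin l) (b b' : Fin m) (c c' : Fin n),
        IsTriangle cls (α (a, b')) (β (b, c')) (γ (c, a')) ↔ (a = a' ∧ b = b' ∧ c = c')

/-- `Realizes` with the triangle condition spelled out (the form inlined by route
`MatrixMultiplication/CommutativeSchemes`); definitional. [cite: CohnUmans2013, Def. 12] -/
theorem realizes_iff (cls : X → X → ι) (l m n : ℕ) :
    Realizes cls l m n ↔
      ∃ (α : Fin l × Fin m → ι) (β : Fin m × Fin n → ι) (γ : Fin n × Fin l → ι),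
        Injective α ∧ Injective β ∧ Injective γ ∧
          ∀ (a a' : Fin l) (b b' : Fin m) (c c' : Fin n),
            (∃ x y z : X, cls x y = α (a, b') ∧ cls y z = β (b, c') ∧ cls z x = γ (c, a')) ↔
              (a = a' ∧ b = b' ∧ c = c') :=
  Iff.rfl

/-- Triangles are preserved by relabelling the classes. [cite: CohnUmans2013, Def. 11] -/
theorem IsTriangle.map (f : ι → κ) {cls : X → X → ι} {i j k : ι} (h : IsTriangle cls i j k) :
    IsTriangle (fun x y => f (cls x y)) (f i) (f j) (f k) := by
  obtain ⟨x, y, z, h1, h2, h3⟩ := h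
  exact ⟨x, y, z, congrArg f h1, congrArg f h2, congrArg f h3⟩

/-- Under an injective relabelling of the classes, triangles correspond exactly (Def. 12 "assumes
a fixed numbering of the classes"; the numbering is immaterial). [cite: CohnUmans2013, Def. 11] -/
theorem isTriangle_map_iff {f : ι → κ} (hf : Injective f) {cls : X → X → ι} {i j k : ι} :
    IsTriangle (fun x y => f (cls x y)) (f i) (f j) (f k) ↔ IsTriangle cls i j k :=
  ⟨fun ⟨x, y, z, h1, h2, h3⟩ => ⟨x, y, z, hf h1, hf h2, hf h3⟩, fun h => h.map f⟩

/-- Realisation is invariant under injective relabelling of the classes (in particular it does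
not depend on the numbering `[r]` of the classes chosen in Def. 12).
[cite: CohnUmans2013, Def. 12] -/
theorem Realizes.map {f : ι → κ} (hf : Injective f) {cls : X → X → ι} {l m n : ℕ}
    (h : Realizes cls l m n) : Realizes (fun x y => f (cls x y)) l m n := by
  obtain ⟨α, β, γ, hα, hβ, hγ, H⟩ := h
  refine ⟨f ∘ α, f ∘ β, f ∘ γ, hf.comp hα, hf.comp hβ, hf.comp hγ, fun a a' b b' c c' => ?_⟩
  rw [← H a a' b b' c c']
  exact isTriangle_map_iff hf

/-- Sanity check (non-vacuity): every class map on a nonempty point set realises `⟨1, 1, 1⟩`,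
through the class of a diagonal pair. [cite: CohnUmans2013, Def. 12] -/
theorem realizes_one_one_one [Nonempty X] (cls : X → X → ι) : Realizes cls 1 1 1 := by
  obtain ⟨x⟩ := ‹Nonempty X›
  refine ⟨fun _ => cls x x, fun _ => cls x x, fun _ => cls x x, fun a b _ => Subsingleton.elim a b,
    fun a b _ => Subsingleton.elim a b, fun a b _ => Subsingleton.elim a b,
    fun a a' b b' c c' => ?_⟩
  exact iff_of_true ⟨x, x, x, rfl, rfl, rfl⟩
    ⟨Subsingleton.elim _ _, Subsingleton.elim _ _, Subsingleton.elim _ _⟩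

end ClassMap

/-! ## Association schemes -/

/-- An **association scheme** on the finite point set `X` with classes labelled by `ι`, in
class-map form (Cohn–Umans 2013 §4.2: a coherent configuration — (1) the diagonal is a union of
classes, (2) closed under transposition `R_i^* = R_{i^*}`, (3) intersection numbers
`#{z : (x,z) ∈ R_i, (z,y) ∈ R_j} = p^k_{ij}` for `(x,y) ∈ R_k` — "is an association scheme if the
diagonal is itself one of the classes"; equivalently Bannai–Ito's not-necessarily-symmetric
association schemes, Brouwer–Cohen–Neumaier §2.1 in the symmetric case). The class of `(x, y)`
is `cls x y : ι`; labels not attained by `cls` are empty classes, so `Fintype.card ι` only bounds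
the rank (`rank`, `rank_le_card`). [cite: CohnUmans2013, §4.2] -/
@[ext]
structure AssociationScheme (X : Type*) (ι : Type*) [Fintype X] [DecidableEq ι] where
  /-- the class map: `cls x y` is the label of the class containing `(x, y)` -/
  cls : X → X → ι
  /-- (1') the diagonal `{(z, z)}` is exactly one class -/
  cls_eq_cls_self_iff : ∀ x y z : X, cls x y = cls z z ↔ x = y
  /-- (2) the transpose of a class is a class: `cls y x` depends only on `cls x y` -/
  exists_transpose : ∃ τ : ι → ι, ∀ x y : X, cls y x = τ (cls x y)
  /-- (3) coherence: the number of `z` with `(x, z)` in class `a` and `(z, y)` in class `b` depends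
  only on `a`, `b` and the class of `(x, y)` (intersection numbers `p a b (cls x y)`) -/
  exists_card_filter_eq : ∃ p : ι → ι → ι → ℕ, ∀ (a b : ι) (x y : X),
    (univ.filter fun z : X => cls x z = a ∧ cls z y = b).card = p a b (cls x y)

namespace AssociationScheme

variable [Fintype X] [DecidableEq ι]

/-- All diagonal pairs lie in the same class. [cite: CohnUmans2013, §4.2] -/
theorem cls_self_eq_cls_self (S : AssociationScheme X ι) (x y : X) : S.cls x x = S.cls y y :=
  (S.cls_eq_cls_self_iff x x y).2 rfl

/-- Only diagonal pairs lie in the diagonal class. [cite: CohnUmans2013, §4.2] -/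
theorem eq_of_cls_eq_cls_self (S : AssociationScheme X ι) {x y z : X} (h : S.cls x y = S.cls z z) :
    x = y :=
  (S.cls_eq_cls_self_iff x y z).1 h

/-- The **rank** of the scheme: the number of nonempty classes (Cohn–Umans 2013 §4.2, "coherent
configuration of rank `r`" = partition into `r` classes). [cite: CohnUmans2013, §4.2] -/
def rank (S : AssociationScheme X ι) : ℕ := (univ.image fun e : X × X => S.cls e.1 e.2).card

/-- The rank is at most the number of labels. [cite: CohnUmans2013, §4.2] -/
theorem rank_le_card [Fintype ι] (S : AssociationScheme X ι) : S.rank ≤ Fintype.card ι :=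
  Finset.card_le_univ _

/-- The scheme is **symmetric** if every class is its own transpose (`R_i^* = R_i`).
[cite: CohnUmans2013, §4.2] -/
def IsSymmetric (S : AssociationScheme X ι) : Prop := ∀ x y : X, S.cls y x = S.cls x y

/-- The scheme is **commutative**: `p^k_{ij} = p^k_{ji}` for all classes — stated intrinsically
(for every pair `(x, y)` the number of `z` with `(x,z) ∈ R_a, (z,y) ∈ R_b` equals the number with
`(x,z) ∈ R_b, (z,y) ∈ R_a`); `isCommutative_iff` is the form with an explicit symmetric table of
intersection numbers. [cite: CohnUmans2013, §4.2] -/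
def IsCommutative (S : AssociationScheme X ι) : Prop := ∀ (a b : ι) (x y : X),
  (univ.filter fun z : X => S.cls x z = a ∧ S.cls z y = b).card =
    (univ.filter fun z : X => S.cls x z = b ∧ S.cls z y = a).card

/-- Commutativity as inlined by route `MatrixMultiplication/CommutativeSchemes`: there is a table
of intersection numbers `p` with `p a b c = p b a c` for ALL labels (on labels that are not
attained the table is unconstrained by coherence, so it can be symmetrised there).
[cite: CohnUmans2013, §4.2] -/
theorem isCommutative_iff (S : AssociationScheme X ι) : S.IsCommutative ↔ ∃ p : ι → ι → ι → ℕ,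
    (∀ (a b : ι) (x y : X),
      (univ.filter fun z : X => S.cls x z = a ∧ S.cls z y = b).card = p a b (S.cls x y)) ∧
    ∀ a b c : ι, p a b c = p b a c := by
  classical
  constructor
  · intro h
    obtain ⟨p, hp⟩ := S.exists_card_filter_eq
    refine ⟨fun a b c => if ∃ x y : X, S.cls x y = c then p a b c else 0, ?_, ?_⟩
    · intro a b x y
      dsimp only
      rw [if_pos ⟨x, y, rfl⟩]
      exact hp a b x y
    · intro a b c
      dsimp only
      by_cases hc : ∃ x y : X, S.cls x y = c
      · rw [if_pos hc, if_pos hc]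
        obtain ⟨x, y, rfl⟩ := hc
        rw [← hp a b x y, ← hp b a x y]
        exact h a b x y
      · rw [if_neg hc, if_neg hc]
  · rintro ⟨p, hp, hsymm⟩ a b x y
    rw [hp, hp, hsymm]

/-- "Symmetry implies commutativity" (Cohn–Umans 2013 §4.2): if every class is self-transposed
then `z ↦ z` matches `{z | (x,z) ∈ R_b, (z,y) ∈ R_a}` with `{z | (y,z) ∈ R_a, (z,x) ∈ R_b}`, whose
size is `p a b (cls y x) = p a b (cls x y)`. [cite: CohnUmans2013, §4.2] -/
theorem IsSymmetric.isCommutative {S : AssociationScheme X ι} (h : S.IsSymmetric) :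
    S.IsCommutative := by
  intro a b x y
  obtain ⟨p, hp⟩ := S.exists_card_filter_eq
  have hset : (univ.filter fun z : X => S.cls x z = b ∧ S.cls z y = a) =
      univ.filter fun z : X => S.cls y z = a ∧ S.cls z x = b := by
    ext z
    simp only [mem_filter, mem_univ, true_and]
    rw [← h z x, ← h y z]
    exact and_comm
  rw [hp a b x y, hset, hp a b y x, h x y]

/-- Triangle of classes of the scheme `S` (Cohn–Umans 2013, Def. 11), dot-notation form of
`IsTriangle S.cls`. [cite: CohnUmans2013, Def. 11] -/
abbrev IsTriangle (S : AssociationScheme X ι) (i j k : ι) : Prop :=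
  AssociationSchemes.IsTriangle S.cls i j k

/-- The scheme `S` **realises `⟨ℓ, m, n⟩`** (Cohn–Umans 2013, Def. 12), dot-notation form of
`Realizes S.cls`. [cite: CohnUmans2013, Def. 12] -/
abbrev Realizes (S : AssociationScheme X ι) (l m n : ℕ) : Prop :=
  AssociationSchemes.Realizes S.cls l m n

/-! ## The association scheme of a finite group (CU13 §4.2) -/

section ofGroup

variable (G : Type*) [Group G] [Fintype G] [DecidableEq G]

/-- In a group, `#{z | x⁻¹ z = a ∧ z⁻¹ y = b}` is `1` if `a b = x⁻¹ y` (then `z = x a`) and `0`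
otherwise — the intersection numbers `p^k_{g,h} = [gh = k]` of the group scheme.
[cite: CohnUmans2013, §4.2] -/
theorem card_filter_inv_mul_eq (a b x y : G) :
    (univ.filter fun z : G => x⁻¹ * z = a ∧ z⁻¹ * y = b).card =
      if a * b = x⁻¹ * y then 1 else 0 := by
  have hset : (univ.filter fun z : G => x⁻¹ * z = a ∧ z⁻¹ * y = b) =
      if a * b = x⁻¹ * y then {x * a} else ∅ := by
    ext z
    simp only [mem_filter, mem_univ, true_and]
    split_ifs with hab
    · simp only [mem_singleton]
      constructor
      · rintro ⟨rfl, -⟩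
        exact (mul_inv_cancel_left x z).symm
      · rintro rfl
        refine ⟨inv_mul_cancel_left x a, ?_⟩
        rw [mul_inv_rev, mul_assoc, ← hab, inv_mul_cancel_left]
    · simp only [Finset.notMem_empty, iff_false, not_and]
      rintro rfl rfl
      exact hab (by group)
  rw [hset]
  split_ifs <;> simp

/-- **The association scheme of a finite group** (Cohn–Umans 2013 §4.2): points `G`, classes
`R_g = {(h, h g) : h ∈ G}` labelled by `g ∈ G`, i.e. `cls h k = h⁻¹ k`; its intersection numbers
are `p^k_{g,h} = 1` if `g h = k` and `0` otherwise ("the group and the corresponding association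
scheme are fully equivalent structures"). [cite: CohnUmans2013, §4.2] -/
def ofGroup : AssociationScheme G G where
  cls x y := x⁻¹ * y
  cls_eq_cls_self_iff x y z := by rw [inv_mul_cancel, inv_mul_eq_one]
  exists_transpose := ⟨fun g => g⁻¹, fun x y => by dsimp only; rw [mul_inv_rev, inv_inv]⟩
  exists_card_filter_eq :=
    ⟨fun a b c => if a * b = c then 1 else 0, fun a b x y => card_filter_inv_mul_eq G a b x y⟩

/-- The class of `(x, y)` in the group scheme is `x⁻¹ y`. [cite: CohnUmans2013, §4.2] -/
@[simp] theorem ofGroup_cls (x y : G) : (ofGroup G).cls x y = x⁻¹ * y := rfl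

end ofGroup

/-- The group scheme of a commutative group is commutative (CU13 §4.2: "this association scheme
is commutative iff `G` is"; the "if" direction). [cite: CohnUmans2013, §4.2] -/
theorem ofGroup_isCommutative (G : Type*) [CommGroup G] [Fintype G] [DecidableEq G] :
    (ofGroup G).IsCommutative := by
  intro a b x y
  show (univ.filter fun z : G => x⁻¹ * z = a ∧ z⁻¹ * y = b).card =
    (univ.filter fun z : G => x⁻¹ * z = b ∧ z⁻¹ * y = a).card
  rw [card_filter_inv_mul_eq, card_filter_inv_mul_eq, mul_comm a b]

end AssociationScheme

end Literature.Combinatorics.AssociationSchemes
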